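import Summits.QuantumFields.YangMills.Theorems.BalabanUVNodesN15TwoSpacingGluingNeumannKnitRightRemainder
import Summits.QuantumFields.YangMills.Theorems.BalabanUVNodesN15NeumannCubeLiftRightEntries
import HarnessLib

/-!
# THE GLUING STEP AT TWO LATTICE SPACINGS, LX: THE ADJOINT REMAINDER ROWS OF A CUT CUBE FROM PRODUCT RIGHT ROWS (any cube operator, any torus `M_ν = 2qw`) — the GENERIC
# BRICKS whose instance on the torus of record is FILE 103 (dag-n15-c g14, FILE 102, v1.1 docstring-only; N15 = NE2, s1 «background-layer OPERATOR ingredient»)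

Cell `pub-ymgap`, seat `pub-ymgap-dag-n15-c` (R134 (a); HUMAN RULING D-0062), generation 14.  `bears_on: R4∕N15 · K3⁸ SpineGivenEndpointR13SepCoPHV (stmt-QuantumFields-27366)`.
Filed `--supports stmt-QuantumFields-27366 --as helper` — COUNT-NEUTRAL.  Theorems only (0 `def`, 0 `sorry`).  Imports BY NAME FILE 95 `…NeumannKnitRightRemainder` (through it FILE 94 §1∕§2 bridges,
FILE 49 `comp_commOp_lapOp` ∕ `hasMaj_comp_mulOp_loc`, FILES 56∕57 (`hasMaj_commOp_nonlocal`, `hasMaj_comp_exp_out`), FILE 67 (partition letters, `coverHb`), FILE 69 (`hasMaj_nonlocalPart`,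
`deltaOp_eq_lapOp_zero_add`, `bgrad_eq_neg_symbOp`), FILE 72 (`chiCube_coverCorner_eq_one_side`), FILE 73 (`MP_eq_two_mul`, `coverMargin_fit`), `maj₀_weaken` ∕ `maj₂_weaken`, dag-n15-a
`hasMaj_landauRe`) and dag-n15-a PROGRAMME P `…NeumannCubeLiftRightEntries` (★★ `hasMaj_chiCube_liftCubeG_sD_mulOp_pair`; through it `…LiftDivergence` ★★ `hasMaj_chiCube_liftCubeG_divAdj_mulOp_pair`,
`…LiftSpacing` `hasMaj_chiCube_liftCubeG_fine`, `…LiftRows` `hasMaj_chiCube_liftCubeG`, `mem_cubeW`); nothing in the tree is modified.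

WHY.  FILE 101 closed FILE 50's socket for the cover's glued `U ≡ 1` pair on the DOUBLED torus, where every cube is half the torus («circular as an estimate»).  The non-circular edition is the
TORUS OF RECORD `2L^{m_T}` with `(2L^{m_T−s})^{d+1}` cubes of FIXED side `L^{s+1}` (FILE 73 `knitGluedR`: the Neumann propagator of each cube's own doubled torus `2L^{s+1}`, lifted along the
reduction by dag-n15-a's `liftCubeG`; size parameter `M = L^s`, volume free).  This file starts the record edition of the RIGHT (adjoint) half of the socket programme (FILES 94–101) — and does it
for ANY cube operator: the adjoint (2.134) piece needs the cube's right first-order entries only MULTIPLIED by the partition's differences, which is how programme P delivers them on the record torus.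

WHAT.  §1 ★★ `hasMaj_comp_commOp_lapOp_of_products` — FILE 94 §1 with PRODUCT right rows `(G∘∇_μ)∘M_{(∇_μh)∘e⁻¹} ≤ 1_S1_Sp₁e^{−δd}`, `(G∘∇⁻_μ)∘M_{(∇⁻_μh)∘e} ≤ 1_S1_Sp₁e^{−δd}` as hypotheses (no
sandwich identities, no separate entry rows): `G∘[Σ∇*∇ + W, M_h] ≤ 1_S1_S(|J|(3βc₂ + 2p₁) + θ_W)e^{−δd}`.  §2 ★★ `hasMaj_cut_comp_commOp_deltaOp_of_products` — FILE 94 §3 for ANY cut cube operator `G_c`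
on a torus `M_ν = 2qw` with the cover's partition `h_k` (side-`S` cubes, `m₀ + 2w + 1 ≤ S ≤ 2qw`): two-sided row `β`, product rows `p₁`, the `∂Π∂*` letter ⟹ `G_c∘[Δ_a, M_{h_k}] ≤ 1_□(y)·Θ·e^{−(δ_m∕2)d}`,
`Θ = (d+1)(3β·32π²∕w² + 2p₁) + βK_Nc_r`.  §3 side-`S` supports `bgrad_coverH_support_side` ∕ `fgrad_coverH_support_side` (FILE 94 §2 for `S ≤ 2qw`).  (v1.1, docstring only, ref-J READ-284:
the record INSTANCE announced here as «§4» is NOT in this file — it landed separately as FILE 103 `…RecordKnitRightRowsTorus`, theorem `hasMaj_chiCube_knitGR_comp_commOp_deltaOp_pair`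
(p640540); cite that, never «FILE 102 §4».)  CONSUMER: FILE 103 and the record twins of FILES 95–101.

HONEST FRAMING ∕ LIMITS.  Block-majorant bookkeeping over LANDED rows; `U ≡ 1` MODEL of [B6] §2's machine on the torus of record (cube letters from each cube's own doubled torus via
programme P: NOT circular in the volume); constants crude and ours; nothing of [B5]∕[B6] (2.38)–(2.40)∕[B9] Thm 3.1, 3.14 asserted.  NE2⁺ NOT PRINTED, NOT proved; N15 NOT discharged; counts of
record UNMOVED (typed 28∕28 · discharged 5∕27); one finite 𝕋⁴ at fixed ε per index — NOT infinite volume, NOT OS on ℝ⁴, NOT a mass gap, NOT Clay; R4 closes `BalabanLadder.UV` only.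
Restate-immune (no Theses import).
-/

noncomputable section

namespace Summit.QuantumFields.YangMills.BalabanUVNodes.N15.Gluing

open Literature.MathematicalPhysics.QuantumFieldTheory.Balaban1983to89
open Literature.MathematicalPhysics.QuantumFieldTheory.Balaban1983to89.B5Prop11Plancherel (Tor fine unitVec)
open Literature.MathematicalPhysics.QuantumFieldTheory.Balaban1983to89.B11SectG (BlockNorm HasMaj RowSum hasMaj_zero)
open Literature.MathematicalPhysics.QuantumFieldTheory.Balaban1983to89.B6Prop26Gluing (mulOp mulOp_apply ind ind_nonneg ind_le_one)
open Literature.MathematicalPhysics.QuantumFieldTheory.Balaban1983to89.T4EtaRateCoeffDefect (pull diagK hasMaj_mulOp)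
open Literature.MathematicalPhysics.QuantumFieldTheory.Balaban1983to89.B6UnitTorusCarrier (unitTorusGeo triangle254_unitTorusGeo rowSum_unitTorusGeo unitTorusGeo_dist_nonneg
  unitTorusGeo_dist_symm unitTorusGeo_dist_self)
open Literature.MathematicalPhysics.QuantumFieldTheory.Balaban1983to89.B5SiteBridgeP12 (MP)
open Literature.MathematicalPhysics.QuantumFieldTheory.King1986.Torus (blockOf tdistT tdistT_nonneg)
open Summit.QuantumFields.YangMills.BalabanUVNodes.N15.VectorPiece (bshiftEquiv bshiftEquiv_apply bshiftEquiv_symm_apply kingPrV blkFine)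
open Summit.QuantumFields.YangMills.BalabanUVNodes.N15.BackgroundLayer (fgrad fgradAdj bgrad fgrad_apply fgradAdj_apply bgrad_apply bgrad_eq_neg_fgradAdj symbOp_sD_eq symbOp_sTinv_sub_one_eq)
open Summit.QuantumFields.YangMills.BalabanUVNodes.N15.TwoGrid (paramsOf deltaOp gOp symbOp sD sTinv chiCube cubeBlocks cubeW mem_cubeW landauRe qvRe qvAdjRe liftCubeG MP_dvd_MP
  hasMaj_landauRe hasMaj_chiCube_liftCubeG hasMaj_chiCube_liftCubeG_fine hasMaj_chiCube_liftCubeG_sD_mulOp_pair hasMaj_chiCube_liftCubeG_divAdj_mulOp_pair)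

variable {d : ℕ}

/-! ## §1 The adjoint (2.134) piece from PRODUCT right rows -/

section Generic

variable {X : Type} [Fintype X] {J : Type} [Fintype J] {g : B6.Geometry} (blk : X → g.Site)

/-- ★★ **THE ADJOINT (2.134) LETTER FROM PRODUCT RIGHT ROWS** — FILE 94 `hasMaj_comp_commOp_lapOp_of_sandwich` with the first-order right entries given directly as the PRODUCTS that
occur in `comp_commOp_lapOp`: `(G∘∇_μ)∘M_{(∇_μh)∘e_μ⁻¹} ≤ 1_S1_Sp₁e^{−δd}`, `(G∘∇*_μ)∘M_{(∇⁻_μh)∘e_μ} ≤ 1_S1_Sp₁e^{−δd}` (`∇⁻ = −∇*`; programme P's shape), the two-sided row `G ≤ 1_S1_Sβe^{−δd}`, the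
partition's second-difference letters `|∇*∇h|, |(∇∇h)∘e⁻¹|, |∇⁻((∇⁻h)∘e)| ≤ c₂` and the `W`-letter `θ_W`:
  `G∘[Σ_μ∇*_μ∇_μ + W, M_h] ≤ 1_S1_S·(|J|(3βc₂ + 2p₁) + θ_W)·e^{−δd}`. [cite: Balaban1984PropagatorsII, (2.133)–(2.134) p.247 (shapes + mechanism, transposed)] -/
theorem hasMaj_comp_commOp_lapOp_of_products {n : ℝ} {e : J → X ≃ X} {W G : (X → ℝ) →ₗ[ℝ] (X → ℝ)} {h : X → ℝ} {S : Set g.Site} {β p₁ c₂ θW δ : ℝ}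
    (hβ : 0 ≤ β) (hc₂ : 0 ≤ c₂)
    (hh2 : ∀ μ x, |fgradAdj n (e μ) (fgrad n (e μ) h) x| ≤ c₂) (hh2f : ∀ μ x, |(fgrad n (e μ) (fgrad n (e μ) h) ∘ ⇑(e μ).symm) x| ≤ c₂)
    (hh2b : ∀ μ x, |bgrad n (e μ) (bgrad n (e μ) h ∘ ⇑(e μ)) x| ≤ c₂)
    (hG : HasMaj (BlockNorm.ofBlocks g blk) (BlockNorm.ofBlocks g blk) G (fun y y' => ind S y * ind S y' * (β * Real.exp (-(δ * g.dist y y')))))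
    (hPD : ∀ μ, HasMaj (BlockNorm.ofBlocks g blk) (BlockNorm.ofBlocks g blk) ((G ∘ₗ fgrad n (e μ)) ∘ₗ mulOp (fgrad n (e μ) h ∘ ⇑(e μ).symm))
      (fun y y' => ind S y * ind S y' * (p₁ * Real.exp (-(δ * g.dist y y')))))
    (hPB : ∀ μ, HasMaj (BlockNorm.ofBlocks g blk) (BlockNorm.ofBlocks g blk) ((G ∘ₗ fgradAdj n (e μ)) ∘ₗ mulOp (bgrad n (e μ) h ∘ ⇑(e μ)))
      (fun y y' => ind S y * ind S y' * (p₁ * Real.exp (-(δ * g.dist y y')))))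
    (hW : HasMaj (BlockNorm.ofBlocks g blk) (BlockNorm.ofBlocks g blk) (G ∘ₗ commOp W h) (fun y y' => ind S y * ind S y' * (θW * Real.exp (-(δ * g.dist y y'))))) :
    HasMaj (BlockNorm.ofBlocks g blk) (BlockNorm.ofBlocks g blk) (G ∘ₗ commOp (lapOp n e W) h)
      (fun y y' => ind S y * ind S y' * ((Fintype.card J * (3 * (β * c₂) + 2 * p₁) + θW) * Real.exp (-(δ * g.dist y y')))) := by
  have hPB' : ∀ μ, HasMaj (BlockNorm.ofBlocks g blk) (BlockNorm.ofBlocks g blk) ((G ∘ₗ bgrad n (e μ)) ∘ₗ mulOp (bgrad n (e μ) h ∘ ⇑(e μ)))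
      (fun y y' => ind S y * ind S y' * (p₁ * Real.exp (-(δ * g.dist y y')))) := fun μ => by
    have e1 := congrArg (fun T : (X → ℝ) →ₗ[ℝ] (X → ℝ) => (G ∘ₗ T) ∘ₗ mulOp (bgrad n (e μ) h ∘ ⇑(e μ))) (bgrad_eq_neg_fgradAdj n (e μ))
    rw [e1, LinearMap.comp_neg, LinearMap.neg_comp]
    exact (hPB μ).neg
  have hterm : ∀ μ, HasMaj (BlockNorm.ofBlocks g blk) (BlockNorm.ofBlocks g blk)
      (G ∘ₗ mulOp (fgradAdj n (e μ) (fgrad n (e μ) h)) -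
        ((G ∘ₗ fgrad n (e μ)) ∘ₗ mulOp (fgrad n (e μ) h ∘ ⇑(e μ).symm) - G ∘ₗ mulOp (fgrad n (e μ) (fgrad n (e μ) h) ∘ ⇑(e μ).symm)) -
        ((G ∘ₗ bgrad n (e μ)) ∘ₗ mulOp (bgrad n (e μ) h ∘ ⇑(e μ)) - G ∘ₗ mulOp (bgrad n (e μ) (bgrad n (e μ) h ∘ ⇑(e μ)))))
      (fun y y' => ind S y * ind S y' * ((3 * (β * c₂) + 2 * p₁) * Real.exp (-(δ * g.dist y y')))) := fun μ => by
    have t0 := hasMaj_comp_mulOp_loc blk hβ hc₂ (hh2 μ) hG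
    have t2 := hasMaj_comp_mulOp_loc blk hβ hc₂ (hh2f μ) hG
    have t4 := hasMaj_comp_mulOp_loc blk hβ hc₂ (hh2b μ) hG
    refine ((t0.sub ((hPD μ).sub t2)).sub ((hPB' μ).sub t4)).mono fun y y' => le_of_eq ?_
    ring
  have hsum := hasMaj_fsum (b₁ := BlockNorm.ofBlocks g blk) (b₃ := BlockNorm.ofBlocks g blk) Finset.univ _ _ fun μ _ => hterm μ
  rw [comp_commOp_lapOp]
  refine (hsum.add hW).mono fun y y' => le_of_eq ?_
  simp only [Finset.sum_const, Finset.card_univ, nsmul_eq_mul]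
  ring

end Generic

/-! ## §2 The adjoint remainder row of a cut cube from product right rows, on the cover `h_k` of a torus `M_ν = 2qw` (any cube operator, side `S`) -/

section Cube

open Real

variable {M : Fin (d + 1) → ℕ} [∀ μ, NeZero (M μ)] {L kk n w q m₀ S : ℕ} [NeZero n]

/-- ★★ **THE ADJOINT REMAINDER ROW OF A CUT CUBE FROM PRODUCT RIGHT ROWS, any cube operator.**  On `M_ν = 2qw` with the cover's partition `h_k` (resolution `w ≥ 1`) and a cube window `S`
(blocks `□_k`), for any operator `G_c` (the cut cube propagator) with two-sided row `1_□1_□βe^{−δ₀d}`, product rows `(G_c∘∇_μ)∘M_{∇⁻_μh_k} , (G_c∘∇*_μ)∘M_{∇_μh_k} ≤ 1_□1_□p₁e^{−δ₀d}`, and the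
Landau letter `∂Π∂* ≤ C₁e^{−δ₁d}`: `G_c∘[Δ_a, M_{h_k}] ≤ 1_□(y)·Θ·e^{−(δ_m∕2)d}`, `δ_m = min δ₀ δ₁`,
`Θ = (d+1)(3β·32π²∕w² + 2p₁) + 0 + β((ℓE⁻¹ + 2ℓ)c_N)c_r`, `ℓ = π(d+1)∕w`, `E = e·δ_m∕4`, `c_N = |a|e^{2δ_m} + C₁`, `c_r = latticeConst_{d+1}(δ_m∕4)` — local part §1 (FILE 67's letters, FILE 94's
bridges), nonlocal part FILE 56 `hasMaj_commOp_nonlocal` behind the two-sided row through FILE 57 `hasMaj_comp_exp_out`.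
[cite: Balaban1984PropagatorsII, (2.91)–(2.93) p.239, (2.133)–(2.135) p.247 (shapes + mechanism, transposed); Balaban1984PropagatorsI, (1.121)–(1.128) pp.37–38] -/
theorem hasMaj_cut_comp_commOp_deltaOp_of_products (hM : ∀ ν, M ν = 2 * q * w) (hw : 0 < w) (k : Fin (d + 1) → ZMod (2 * q))
    {Gc : (Tor (fine n M) × Fin (d + 1) → ℝ) →ₗ[ℝ] (Tor (fine n M) × Fin (d + 1) → ℝ)} {a β δ₀ C₁ δ₁ p₁ : ℝ} (hβ : 0 ≤ β) (hδ₀ : 0 < δ₀) (hC₁ : 0 ≤ C₁) (hδ₁ : 0 < δ₁) (hp₁ : 0 ≤ p₁)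
    (hG : HasMaj (BlockNorm.ofBlocks (unitTorusGeo L kk M) (fun b : Tor (fine n M) × Fin (d + 1) => blockOf n M b.1))
      (BlockNorm.ofBlocks (unitTorusGeo L kk M) (fun b : Tor (fine n M) × Fin (d + 1) => blockOf n M b.1)) Gc
      (fun y y' => ind ((cubeBlocks M (coverCorner M w q m₀ k) S : Finset (Tor M)) : Set (Tor M)) y * ind ((cubeBlocks M (coverCorner M w q m₀ k) S : Finset (Tor M)) : Set (Tor M)) y' *
        (β * Real.exp (-(δ₀ * tdistT M y y')))))
    (hPD : ∀ μ, HasMaj (BlockNorm.ofBlocks (unitTorusGeo L kk M) (fun b : Tor (fine n M) × Fin (d + 1) => blockOf n M b.1))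
      (BlockNorm.ofBlocks (unitTorusGeo L kk M) (fun b : Tor (fine n M) × Fin (d + 1) => blockOf n M b.1))
      ((Gc ∘ₗ fgrad (n : ℝ) (bshiftEquiv M n μ)) ∘ₗ mulOp (fgrad (n : ℝ) (bshiftEquiv M n μ) (hcube (2 * q) (coverXi M n w) k) ∘ ⇑(bshiftEquiv M n μ).symm))
      (fun y y' => ind ((cubeBlocks M (coverCorner M w q m₀ k) S : Finset (Tor M)) : Set (Tor M)) y * ind ((cubeBlocks M (coverCorner M w q m₀ k) S : Finset (Tor M)) : Set (Tor M)) y' *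
        (p₁ * Real.exp (-(δ₀ * tdistT M y y')))))
    (hPB : ∀ μ, HasMaj (BlockNorm.ofBlocks (unitTorusGeo L kk M) (fun b : Tor (fine n M) × Fin (d + 1) => blockOf n M b.1))
      (BlockNorm.ofBlocks (unitTorusGeo L kk M) (fun b : Tor (fine n M) × Fin (d + 1) => blockOf n M b.1))
      ((Gc ∘ₗ fgradAdj (n : ℝ) (bshiftEquiv M n μ)) ∘ₗ mulOp (bgrad (n : ℝ) (bshiftEquiv M n μ) (hcube (2 * q) (coverXi M n w) k) ∘ ⇑(bshiftEquiv M n μ)))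
      (fun y y' => ind ((cubeBlocks M (coverCorner M w q m₀ k) S : Finset (Tor M)) : Set (Tor M)) y * ind ((cubeBlocks M (coverCorner M w q m₀ k) S : Finset (Tor M)) : Set (Tor M)) y' *
        (p₁ * Real.exp (-(δ₀ * tdistT M y y')))))
    (hNL : HasMaj (BlockNorm.ofBlocks (unitTorusGeo L kk M) (fun b : Tor (fine n M) × Fin (d + 1) => blockOf n M b.1))
      (BlockNorm.ofBlocks (unitTorusGeo L kk M) (fun b : Tor (fine n M) × Fin (d + 1) => blockOf n M b.1)) (landauRe M n) (fun y y' => C₁ * Real.exp (-(δ₁ * tdistT M y y')))) :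
    HasMaj (BlockNorm.ofBlocks (unitTorusGeo L kk M) (fun b : Tor (fine n M) × Fin (d + 1) => blockOf n M b.1))
      (BlockNorm.ofBlocks (unitTorusGeo L kk M) (fun b : Tor (fine n M) × Fin (d + 1) => blockOf n M b.1))
      (Gc ∘ₗ commOp (deltaOp M n a) (hcube (2 * q) (coverXi M n w) k))
      (fun y y' => ind ((cubeBlocks M (coverCorner M w q m₀ k) S : Finset (Tor M)) : Set (Tor M)) y *
        ((((d + 1 : ℕ) : ℝ) * (3 * (β * (32 * π ^ 2 / (w : ℝ) ^ 2)) + 2 * p₁) + 0 +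
          β * ((π * (d + 1) / w * (Real.exp 1 * (min δ₀ δ₁ / 4))⁻¹ + 2 * (π * (d + 1) / w)) * (|a| * (Real.exp (min δ₀ δ₁) * Real.exp (min δ₀ δ₁)) + C₁)) *
            B4Sect5Proof.latticeConst (d + 1) (min δ₀ δ₁ / 4)) *
          Real.exp (-(min δ₀ δ₁ / 2 * tdistT M y y')))) := by
  have hwR : (0 : ℝ) < w := by exact_mod_cast hw
  have hδm : 0 < min δ₀ δ₁ := lt_min hδ₀ hδ₁
  have hc₂ : (0 : ℝ) ≤ 32 * π ^ 2 / (w : ℝ) ^ 2 := by positivity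
  -- the partition's second-difference letters (FILE 67) and FILE 94's bridges
  have hh2 := fun μ x => abs_fgradAdj_fgrad_coverH_le (n := n) hM hw k μ x
  have hh2f : ∀ (μ : Fin (d + 1)) (x : Tor (fine n M) × Fin (d + 1)),
      |(fgrad (n : ℝ) (bshiftEquiv M n μ) (fgrad (n : ℝ) (bshiftEquiv M n μ) (hcube (2 * q) (coverXi M n w) k)) ∘ ⇑(bshiftEquiv M n μ).symm) x| ≤ 32 * π ^ 2 / (w : ℝ) ^ 2 :=
    fun μ x => by rw [Function.comp_apply, fgrad_fgrad_apply_eq, Equiv.apply_symm_apply, abs_neg]; exact hh2 μ x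
  have hh2b : ∀ (μ : Fin (d + 1)) (x : Tor (fine n M) × Fin (d + 1)),
      |bgrad (n : ℝ) (bshiftEquiv M n μ) (bgrad (n : ℝ) (bshiftEquiv M n μ) (hcube (2 * q) (coverXi M n w) k) ∘ ⇑(bshiftEquiv M n μ)) x| ≤ 32 * π ^ 2 / (w : ℝ) ^ 2 :=
    fun μ x => by rw [bgrad_comp_eq_fgrad, bgrad_fgrad_apply_eq, abs_neg]; exact hh2 μ x
  -- the `W = 0` letter
  have hW : HasMaj (BlockNorm.ofBlocks (unitTorusGeo L kk M) (fun b : Tor (fine n M) × Fin (d + 1) => blockOf n M b.1))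
      (BlockNorm.ofBlocks (unitTorusGeo L kk M) (fun b : Tor (fine n M) × Fin (d + 1) => blockOf n M b.1))
      (Gc ∘ₗ commOp (0 : (Tor (fine n M) × Fin (d + 1) → ℝ) →ₗ[ℝ] (Tor (fine n M) × Fin (d + 1) → ℝ)) (hcube (2 * q) (coverXi M n w) k))
      (fun y y' => ind ((cubeBlocks M (coverCorner M w q m₀ k) S : Finset (Tor M)) : Set (Tor M)) y *
        ind ((cubeBlocks M (coverCorner M w q m₀ k) S : Finset (Tor M)) : Set (Tor M)) y' * (0 * Real.exp (-(δ₀ * tdistT M y y')))) := by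
    rw [commOp_zero_left, LinearMap.comp_zero]
    exact (hasMaj_zero _ _).mono fun y y' => le_of_eq (by ring)
  -- THE LOCAL PART (§1)
  have hloc := hasMaj_comp_commOp_lapOp_of_products (g := unitTorusGeo L kk M) (fun b : Tor (fine n M) × Fin (d + 1) => blockOf n M b.1)
    (S := ((cubeBlocks M (coverCorner M w q m₀ k) S : Finset (Tor M)) : Set (Tor M))) hβ hc₂ hh2 hh2f hh2b hG hPD hPB hW
  rw [Fintype.card_fin] at hloc
  -- THE NONLOCAL PART: the commutator letter of `N = aQ*Q − ∂Π∂*` behind the two-sided row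
  have hN' := hasMaj_nonlocalPart (L := L) (kk := kk) (a := a) hC₁ hδm.le (min_le_right δ₀ δ₁) hNL
  have hcN : 0 ≤ |a| * (Real.exp (min δ₀ δ₁) * Real.exp (min δ₀ δ₁)) + C₁ := by positivity
  have h1 := hasMaj_commOp_nonlocal (g := unitTorusGeo L kk M) (fun b : Tor (fine n M) × Fin (d + 1) => blockOf n M b.1) (h := hcube (2 * q) (coverXi M n w) k)
    (hb := coverHb M n w q k) hcN (by positivity : (0 : ℝ) ≤ π * (d + 1) / w) (by positivity : (0 : ℝ) ≤ π * (d + 1) / w) (by positivity : (0 : ℝ) < min δ₀ δ₁ / 4)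
    (unitTorusGeo_dist_nonneg L kk M) (unitTorusGeo_dist_symm L kk M) (fun y y' => abs_coverHb_sub_le hM hw k y y') (fun x => abs_coverH_sub_coverHb_le hM hw k x) hN'
  have hrow := rowSum_unitTorusGeo (L := L) (k := kk) (M := M) (σ := min δ₀ δ₁ / 4) (by positivity)
  have hcK : (0 : ℝ) ≤ (π * (d + 1) / w * (Real.exp 1 * (min δ₀ δ₁ / 4))⁻¹ + 2 * (π * (d + 1) / w)) * (|a| * (Real.exp (min δ₀ δ₁) * Real.exp (min δ₀ δ₁)) + C₁) := by
    positivity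
  have hnl := hasMaj_comp_exp_out (g := unitTorusGeo L kk M) (fun b : Tor (fine n M) × Fin (d + 1) => blockOf n M b.1) (triangle254_unitTorusGeo L kk M)
    (unitTorusGeo_dist_nonneg L kk M) hrow hβ hcK (by positivity : (0 : ℝ) ≤ min δ₀ δ₁ / 2) (by linarith : min δ₀ δ₁ / 2 ≤ min δ₀ δ₁ - min δ₀ δ₁ / 4)
    (by linarith [min_le_left δ₀ δ₁] : min δ₀ δ₁ / 2 + min δ₀ δ₁ / 4 ≤ δ₀) hG h1
  -- THE SUM
  have hθloc : (0 : ℝ) ≤ ((d + 1 : ℕ) : ℝ) * (3 * (β * (32 * π ^ 2 / (w : ℝ) ^ 2)) + 2 * p₁) + 0 := by positivity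
  rw [deltaOp_eq_lapOp_zero_add, commOp_add_left, LinearMap.comp_add]
  refine (hloc.add hnl).mono fun y y' => ?_
  have t1 := loc₂_le_loc₁ (L := L) (kk := kk) (S := ((cubeBlocks M (coverCorner M w q m₀ k) S : Finset (Tor M)) : Set (Tor M))) hθloc
    (by linarith [min_le_left δ₀ δ₁] : min δ₀ δ₁ / 2 ≤ δ₀) y y'
  refine (add_le_add t1 le_rfl).trans (le_of_eq ?_)
  simp only [unitTorusGeo]
  ring

end Cube

/-! ## §3 Side-`S` supports of the partition's differences (FILE 94 §2 for `m₀ + 2w + 1 ≤ S ≤ 2qw`) -/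

section Supports

variable {M : Fin (d + 1) → ℕ} [∀ μ, NeZero (M μ)] {n w q m₀ S : ℕ} [NeZero n]

/-- A nonzero `(∇_μh_k)(x − e_μ)` forces the blocks of `x` and `x − e_μ` into the side-`S` cube `□_k` (FILE 94 `bgrad_coverH_support` for `m₀ + 2w + 1 ≤ S ≤ 2qw`). [folklore] -/
theorem bgrad_coverH_support_side (hM : ∀ ν, M ν = 2 * q * w) (hw : 0 < w) (hfit : m₀ + 2 * w + 1 ≤ S) (hS : S ≤ 2 * q * w) (μ : Fin (d + 1)) (k : Fin (d + 1) → ZMod (2 * q))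
    (b : Tor (fine n M) × Fin (d + 1)) (hb : (fgrad (n : ℝ) (bshiftEquiv M n μ) (hcube (2 * q) (coverXi M n w) k) ∘ ⇑(bshiftEquiv M n μ).symm) b ≠ 0) :
    blockOf n M b.1 ∈ cubeBlocks M (coverCorner M w q m₀ k) S ∧ blockOf n M (b.1 - unitVec (fine n M) μ) ∈ cubeBlocks M (coverCorner M w q m₀ k) S := by
  have hχ := chiCube_coverCorner_eq_one_side (M := M) (n := n) (m₀ := m₀) hM hw hfit hS μ k
  have mem : ∀ x : Tor (fine n M) × Fin (d + 1), chiCube M n (coverCorner M w q m₀ k) S x = 1 → blockOf n M x.1 ∈ cubeBlocks M (coverCorner M w q m₀ k) S := fun x hx => by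
    unfold chiCube at hx
    by_contra hb'
    rw [if_neg hb'] at hx
    exact zero_ne_one hx
  have hne : hcube (2 * q) (coverXi M n w) k b ≠ 0 ∨ hcube (2 * q) (coverXi M n w) k ((bshiftEquiv M n μ).symm b) ≠ 0 := by
    by_contra h0
    push Not at h0
    apply hb
    simp only [Function.comp_apply, fgrad_apply, Equiv.apply_symm_apply, h0.1, h0.2, sub_self, mul_zero]
  have h2 : blockOf n M ((bshiftEquiv M n μ).symm b).1 = blockOf n M (b.1 - unitVec (fine n M) μ) := by rw [bshiftEquiv_symm_apply]
  rcases hne with h | h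
  · refine ⟨mem b (chi_eq_one_of_hcube_ne_zero (2 * q) (coverXi M n w) (bshiftEquiv M n) μ hχ (Or.inl rfl) h), ?_⟩
    rw [← h2]
    exact mem _ (chi_eq_one_of_hcube_ne_zero (2 * q) (coverXi M n w) (bshiftEquiv M n) μ hχ (Or.inr (Or.inl ((bshiftEquiv M n μ).apply_symm_apply b).symm)) h)
  · refine ⟨mem b (chi_eq_one_of_hcube_ne_zero (2 * q) (coverXi M n w) (bshiftEquiv M n) μ hχ (Or.inr (Or.inr rfl)) h), ?_⟩
    rw [← h2]
    exact mem _ (chi_eq_one_of_hcube_ne_zero (2 * q) (coverXi M n w) (bshiftEquiv M n) μ hχ (Or.inl rfl) h)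

/-- A nonzero `(∇⁻_μh_k)(x + e_μ)` forces the blocks of `x` and `x + e_μ` into the side-`S` cube `□_k` (FILE 94 `fgrad_coverH_support` for `S ≤ 2qw`). [folklore] -/
theorem fgrad_coverH_support_side (hM : ∀ ν, M ν = 2 * q * w) (hw : 0 < w) (hfit : m₀ + 2 * w + 1 ≤ S) (hS : S ≤ 2 * q * w) (μ : Fin (d + 1)) (k : Fin (d + 1) → ZMod (2 * q))
    (b : Tor (fine n M) × Fin (d + 1)) (hb : (bgrad (n : ℝ) (bshiftEquiv M n μ) (hcube (2 * q) (coverXi M n w) k) ∘ ⇑(bshiftEquiv M n μ)) b ≠ 0) :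
    blockOf n M b.1 ∈ cubeBlocks M (coverCorner M w q m₀ k) S ∧ blockOf n M (b.1 + unitVec (fine n M) μ) ∈ cubeBlocks M (coverCorner M w q m₀ k) S := by
  have hχ := chiCube_coverCorner_eq_one_side (M := M) (n := n) (m₀ := m₀) hM hw hfit hS μ k
  have mem : ∀ x : Tor (fine n M) × Fin (d + 1), chiCube M n (coverCorner M w q m₀ k) S x = 1 → blockOf n M x.1 ∈ cubeBlocks M (coverCorner M w q m₀ k) S := fun x hx => by
    unfold chiCube at hx
    by_contra hb'
    rw [if_neg hb'] at hx
    exact zero_ne_one hx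
  have hne : hcube (2 * q) (coverXi M n w) k b ≠ 0 ∨ hcube (2 * q) (coverXi M n w) k (bshiftEquiv M n μ b) ≠ 0 := by
    by_contra h0
    push Not at h0
    apply hb
    simp only [Function.comp_apply, bgrad_apply, Equiv.symm_apply_apply, h0.1, h0.2, sub_self, mul_zero]
  have h2 : blockOf n M (bshiftEquiv M n μ b).1 = blockOf n M (b.1 + unitVec (fine n M) μ) := by rw [bshiftEquiv_apply]
  rcases hne with h | h
  · refine ⟨mem b (chi_eq_one_of_hcube_ne_zero (2 * q) (coverXi M n w) (bshiftEquiv M n) μ hχ (Or.inl rfl) h), ?_⟩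
    rw [← h2]
    exact mem _ (chi_eq_one_of_hcube_ne_zero (2 * q) (coverXi M n w) (bshiftEquiv M n) μ hχ (Or.inr (Or.inr ((bshiftEquiv M n μ).symm_apply_apply b).symm)) h)
  · refine ⟨mem b (chi_eq_one_of_hcube_ne_zero (2 * q) (coverXi M n w) (bshiftEquiv M n) μ hχ (Or.inr (Or.inl rfl)) h), ?_⟩
    rw [← h2]
    exact mem _ (chi_eq_one_of_hcube_ne_zero (2 * q) (coverXi M n w) (bshiftEquiv M n) μ hχ (Or.inl rfl) h)

end Supports

end Summit.QuantumFields.YangMills.BalabanUVNodes.N15.Gluing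

end
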